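/-
Copyright (c) 2026 the pub-hodgecm-mathlib formalisation cell (harness21).  Prover seat hodgecm-mathlib-K2E4-p14 (g5), Track B ∕ K2-LIT, h413 =
`stmt-HodgeConjecture-24833`, line `K2_E1_TraceFormulaBeta`, campaign «EIS-RANK-ONE» rung R6f(ii); DEAL «EIS-R6-CM» of the dealer K2E1-plan (g3) 2026-09-04T05:26:42Z,
cut (C2): the Maass–Selberg relation for FLAT SECTIONS of `U(J₃)` — the hypothesis-first ★ relation with its four bracket inputs DISCHARGED (★ (C1)), generic and CM.
-/
import Summits.HodgeConjecture.HodgeConjecture.Theorems.K2E1MaassSelbergBracketsThree       -- ★ p857654 (this seat): (C1) the four flat-section brackets over ★ (δ)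
import Summits.HodgeConjecture.HodgeConjecture.Theorems.K2E1BorelEisensteinGodementCMThree  -- ★ p857478 (K2E1-p08 g4): R2 CM `summable_eisensteinSeriesU_flatSectionU_cm_three`, CM facts
import Summits.HodgeConjecture.HodgeConjecture.Theorems.K2E1BorelWeightAverage            -- ★ p857644 (K2E4-p11 g3): «AVG» `integral_wt_smul_mul_conj_eq_mul_conj_borelConstantTerm_three` (ED. 2)
import HarnessLib

/-!
# K2·E1 — `K2E1MaassSelbergCMThree`: THE MAASS–SELBERG RELATION FOR FLAT SECTIONS OF `U(J₃)` — GENERIC QUADRATIC `(F,E,c)` AND THE CM PAIR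
# (campaign «EIS-RANK-ONE», rung R6f(ii), cut (C2) of «EIS-R6-CM»: ★ `maassSelberg_inner_truncation_three` with `hδ₁…hδ₄`, `hi₁…hi₄`, `hs₁`, `hs₂` (and `hsum` at CM) discharged)

Track B ∕ K2-LIT, crux h413 = `stmt-HodgeConjecture-24833`, route of record `HCCMUnconditional`; cell `hodgecm-mathlib`, squad K2, ENGINE E1.  Prover seat
`hodgecm-mathlib-K2E4-p14` (g5); DEAL «EIS-R6-CM» of the dealer K2E1-plan (g3) 2026-09-04T05:26:42Z, REPORT-FIRST 05:37Z.  THEOREMS ONLY (no `def`, no `instance`, no notation,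
no named-fact hypothesis, no `sorry`); lane `--supports stmt-HodgeConjecture-24833 --as helper` (count-neutral).  Closes no socket.

THE MATHEMATICS [MoeglinWaldspurger1995, IV.2.1–IV.2.3; Arthur1980TraceFormulaII, §4; Garrett2018, §11.3].  `f = flatSectionU φ z`, `f′ = flatSectionU φ′ z′` (★ R1 p857359), their
intertwined sections `Mf = flatSectionU φ̃ (2 − z)`, `Mf′ = flatSectionU φ̃′ (2 − z′)` (exponent `2ρ − z`, `2ρ = 2` for `U(2,1)`; the coefficients `φ̃, φ̃′` enter ABSTRACTLY, their
relation to the intertwining integral riding in `hCT`∕`hCT′`), on the sub-tube `2 < Re z′ < Re z`.  §1 **`maassSelberg_flatSectionU_three`** (generic `[E:F] = 2`, `c² = 1`, `c ≠ 1`,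
Iwasawa `hBK`): ★ `maassSelberg_inner_truncation_three` with **`s₁ := z + conj z′ − 2`, `s₂ := z − conj z′`** (`0 < Re sᵢ` from the sub-tube), the four weight-level → idele-class
inputs `hδ₁…hδ₄` and the integrabilities `hi₁…hi₄` DISCHARGED by ★ (C1) `exists_integral_weight_smul_cutoffs_flatSectionU_mul_conj_eq_three` at
`(α,a,α′,a′) = (φ,z,φ′,z′), (φ,z,φ̃′,2−z′), (φ̃,2−z,φ′,z′), (φ̃,2−z,φ̃′,2−z′)` — the identities `a + conj a′ = s₁+2, s₂+2, −s₂+2, −s₁+2` are the checked sign∕exponent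
bookkeeping — giving **`⟨Λ^T E f, Λ′⟩_X = c_μ·K·((T^{s₁}∕s₁)[Ξ₁] + (T^{s₂}∕s₂)[Ξ₂] − (T^{−s₂}∕s₂)[Ξ₃] − (T^{−s₁}∕s₁)[Ξ₄])`**, `[Ξ] = ∫_{𝓕_I ∩ {‖x‖≤1}} ‖x‖·Ξ dν_I`, where `Ξ₁…Ξ₄`
are the `K_U`-averages of the coefficient pairs along the torus pushed to `𝕀_E` (hypotheses `hΞᵢ`; ★ p857588 decides them per torus character).  §2 **`maassSelberg_flatSectionU_cm_three`**:
the CM pair `(L⁺, L, conj)` — `h2`, `hc`, `hc1`, Iwasawa ★ and the summability `hsum` ★ R2 CM `summable_eisensteinSeriesU_flatSectionU_cm_three` (`Re z > 2`, `‖φ‖ ≤ C`) DISCHARGED.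
NAMED INPUTS KEPT (supplier): `hCT` (★ R3 `borelConstantTerm_eisensteinSeriesU_three` under its Godement `hfin`), `hCT′`∕`hM′ψ` (★ R3 + ★ R6a∕R6c), `hadj` (★ p857605 + `integral_conj`,
intertwining convergence), `hAVG` (★ p857644 `integral_wt_smul_mul_conj_eq_mul_conj_borelConstantTerm_three`), `hi₅`, `hψL1`, `Λ′` Borel `G(F)`-invariant bounded (★ R6e p857514 ∘
`hdec`), coefficient facts, `hΞᵢ`.
HONEST LABEL: HC_CM is proved only modulo the 7 printed citations (2 remaining named inputs: hLiu418 = `stmt-HodgeConjecture-24832`, h413 = `stmt-HodgeConjecture-24833`) until rung 0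
closes; this file asserts no named fact and closes no socket.
References: [MoeglinWaldspurger1995] IV.2.1–IV.2.3 · [Arthur1980TraceFormulaII] §4 · [Garrett2018] §11.3 · [Rogawski1990] §2.2, §7.3.
-/

set_option autoImplicit false
-- the mandated namespace repeats the single-problem summit's segment (`HodgeConjecture.HodgeConjecture`)
set_option linter.dupNamespace false

noncomputable section

open MeasureTheory Measure NumberField IsDedekindDomain Set MulAction
open scoped ENNReal NNReal ComplexConjugate
open Literature.MeasureTheory.Group Literature.NumberTheory
open Literature.NumberTheory.Automorphic Literature.NumberTheory.Automorphic.UnitaryGroup AdelicGroupData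
open Summit.HodgeConjecture.HodgeConjecture.Cruxes.H413.K2E1BorelEisensteinU
open Summit.HodgeConjecture.HodgeConjecture.Cruxes.H413.K2E1IdeleClassMellinWeighted
open Summit.HodgeConjecture.HodgeConjecture.Cruxes.H413.K2E1TorusHeightMellin
open Summit.HodgeConjecture.HodgeConjecture.Cruxes.H413.K2E1MaassSelbergFourBrackets
open Summit.HodgeConjecture.HodgeConjecture.Cruxes.H413.K2E1MaassSelbergU
open Summit.HodgeConjecture.HodgeConjecture.Cruxes.H413.K2E1MaassSelbergBracketsThree
open Summit.HodgeConjecture.HodgeConjecture.Cruxes.H413.K2E1BorelEisensteinGodementCMThree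

namespace Summit.HodgeConjecture.HodgeConjecture.Cruxes.H413.K2E1MaassSelbergCMThree

/-! ## §1 Generic quadratic `(F, E, c)`: the relation for flat sections, `hδᵢ`∕`hiᵢ`∕`hsᵢ` discharged -/

section Generic

variable {F E : Type} [Field F] [NumberField F] [Field E] [NumberField E] [Algebra F E] {c : E ≃ₐ[F] E}
variable [MeasurableSpace (quasiSplit F E c 3).Adelic] [BorelSpace (quasiSplit F E c 3).Adelic]
variable [MeasurableSpace (adelicUnipotent F E c 3)]
variable [MeasurableSpace (AdeleRing (𝓞 E) E)ˣ] [BorelSpace (AdeleRing (𝓞 E) E)ˣ]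

/-- **THE MAASS–SELBERG RELATION FOR FLAT SECTIONS OF `U(J₃)`** (generic quadratic `E/F`, `[E:F] = 2`, `c² = 1`, `c ≠ 1`; sub-tube `2 < Re z′ < Re z`): ★ `maassSelberg_inner_truncation_three`
at `f = φ·H^z`, `f′ = φ′·H^{z′}`, `Mf = φ̃·H^{2−z}`, `Mf′ = φ̃′·H^{2−z′}` with `s₁ = z + conj z′ − 2`, `s₂ = z − conj z′`, the four weight-level → idele-class brackets and their
integrabilities DISCHARGED by ★ (C1); the remaining analytic inputs are named (docstring above). [cite: MoeglinWaldspurger1995, IV.2.1–IV.2.3] [cite: Arthur1980TraceFormulaII, §4]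
[cite: Garrett2018, §11.3] -/
theorem maassSelberg_flatSectionU_three (h2 : Module.finrank F E = 2) (hc : c * c = 1) (hc1 : c ≠ 1)
    (μ : Measure (quasiSplit F E c 3).automorphicQuotient) [(quasiSplit F E c 3).IsAutomorphicMeasure μ]
    (νG : Measure (quasiSplit F E c 3).Adelic) [νG.IsHaarMeasure] [νG.IsInvInvariant]
    (μK : Measure ((standardMaximalCompactGL 3 E).comap (adelicVal F E c 3 ((StdForm.antidiagonal 3).over E)) : Subgroup (quasiSplit F E c 3).Adelic))
    [μK.IsHaarMeasure]
    (νI : Measure (AdeleRing (𝓞 E) E)ˣ) [νI.IsHaarMeasure]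
    (hBK : ∀ g : (quasiSplit F E c 3).Adelic, ∃ b ∈ borelAdelic F E c 3, ∃ k : (quasiSplit F E c 3).Adelic,
      adelicVal F E c 3 ((StdForm.antidiagonal 3).over E) k ∈ standardMaximalCompactGL 3 E ∧ g = b * k)
    {𝓕I : Set (AdeleRing (𝓞 E) E)ˣ} (h𝓕I : IsIdeleClassDomain E 𝓕I) :
    ∃ cμ K : ℝ, 0 < cμ ∧ 0 < K ∧
      ∀ {β : (quasiSplit F E c 3).Adelic → ℝ≥0∞}, IsCoveringWeight ((arithmeticBorel F E c 3).map (quasiSplit F E c 3).arithmeticSubgroup.subtype) β →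
      ∀ {ν : Measure (adelicUnipotent F E c 3)} {𝓕 : Set (adelicUnipotent F E c 3)} {T : ℝ≥0}, 1 ≤ T →
      -- the four COEFFICIENTS `φ, φ′` (sections) and `φ̃, φ̃′` (intertwined sections): Borel, left-`N(𝔸)`∕`B(F)`-invariant, bounded
      ∀ {φ φ' φt φt' : (quasiSplit F E c 3).Adelic → ℂ},
      Measurable φ →
        (∀ (n : unipotentInBorel F E c 3) (y : (quasiSplit F E c 3).Adelic), φ (((n : borelAdelic F E c 3) : (quasiSplit F E c 3).Adelic) * y) = φ y) →
        (∀ b ∈ arithmeticBorel F E c 3, ∀ y : (quasiSplit F E c 3).Adelic, φ ((b : (quasiSplit F E c 3).Adelic) * y) = φ y) →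
      ∀ {Cφ : ℝ}, (∀ x, ‖φ x‖ ≤ Cφ) →
      Measurable φ' →
        (∀ (n : unipotentInBorel F E c 3) (y : (quasiSplit F E c 3).Adelic), φ' (((n : borelAdelic F E c 3) : (quasiSplit F E c 3).Adelic) * y) = φ' y) →
        (∀ b ∈ arithmeticBorel F E c 3, ∀ y : (quasiSplit F E c 3).Adelic, φ' ((b : (quasiSplit F E c 3).Adelic) * y) = φ' y) →
      ∀ {Cφ' : ℝ}, (∀ x, ‖φ' x‖ ≤ Cφ') →
      Measurable φt →
        (∀ (n : unipotentInBorel F E c 3) (y : (quasiSplit F E c 3).Adelic), φt (((n : borelAdelic F E c 3) : (quasiSplit F E c 3).Adelic) * y) = φt y) →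
        (∀ b ∈ arithmeticBorel F E c 3, ∀ y : (quasiSplit F E c 3).Adelic, φt ((b : (quasiSplit F E c 3).Adelic) * y) = φt y) →
      ∀ {Cφt : ℝ}, (∀ x, ‖φt x‖ ≤ Cφt) →
      Measurable φt' →
        (∀ (n : unipotentInBorel F E c 3) (y : (quasiSplit F E c 3).Adelic), φt' (((n : borelAdelic F E c 3) : (quasiSplit F E c 3).Adelic) * y) = φt' y) →
        (∀ b ∈ arithmeticBorel F E c 3, ∀ y : (quasiSplit F E c 3).Adelic, φt' ((b : (quasiSplit F E c 3).Adelic) * y) = φt' y) →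
      ∀ {Cφt' : ℝ}, (∀ x, ‖φt' x‖ ≤ Cφt') →
      -- the exponents on the sub-tube
      ∀ {z z' : ℂ}, 2 < z'.re → z'.re < z.re →
      -- NAMED INPUTS: constant term of `E(f_z)` (★ R3), summability (★ R2), the truncated second series `Λ′` (★ R6e), averaging∕two-piece CT∕adjoint∕R6a (★ AVG∕R3∕p857605∕R6a-c)
        (∀ x : (quasiSplit F E c 3).Adelic, T < borelHeight x → borelConstantTerm ν 𝓕 (eisensteinSeriesU (flatSectionU φ z)) x = flatSectionU φ z x + flatSectionU φt (2 - z) x) →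
        (∀ g : (quasiSplit F E c 3).Adelic,
          Summable fun q : Quotient (orbitRel ↥(borelU (c : E →+* E) ((StdForm.antidiagonal 3).over E)) ↥(unitaryGroupOfForm (c : E →+* E) ((StdForm.antidiagonal 3).over E))) =>
            flatSectionU φ z ((quasiSplit F E c 3).toAdelic (q.out : ↥(unitaryGroupOfForm (c : E →+* E) ((StdForm.antidiagonal 3).over E))) * g)) →
      ∀ {Λ' CT' : (quasiSplit F E c 3).Adelic → ℂ} {M M' : ((quasiSplit F E c 3).Adelic → ℂ) → ((quasiSplit F E c 3).Adelic → ℂ)},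
        Measurable Λ' → (∀ (γ : (quasiSplit F E c 3).arithmeticSubgroup) (x : (quasiSplit F E c 3).Adelic), Λ' ((γ : (quasiSplit F E c 3).Adelic) * x) = Λ' x) →
        ∀ {M₁ : ℝ}, (∀ g, ‖Λ' g‖ ≤ M₁) →
        ∫⁻ g, β g * ‖({y : (quasiSplit F E c 3).Adelic | borelHeight y ≤ T}.indicator (flatSectionU φ z) g - {y : (quasiSplit F E c 3).Adelic | T < borelHeight y}.indicator (flatSectionU φt (2 - z)) g)‖ₑ ∂νG < ∞ →
        ∫ g, (β g).toReal • (({y : (quasiSplit F E c 3).Adelic | borelHeight y ≤ T}.indicator (flatSectionU φ z) g - {y : (quasiSplit F E c 3).Adelic | T < borelHeight y}.indicator (flatSectionU φt (2 - z)) g) * conj (Λ' g)) ∂νG = ∫ g, (β g).toReal • (({y : (quasiSplit F E c 3).Adelic | borelHeight y ≤ T}.indicator (flatSectionU φ z) g - {y : (quasiSplit F E c 3).Adelic | T < borelHeight y}.indicator (flatSectionU φt (2 - z)) g) * conj (CT' g)) ∂νG →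
        (∀ g, CT' g = {y : (quasiSplit F E c 3).Adelic | borelHeight y ≤ T}.indicator (flatSectionU φ' z' + flatSectionU φt' (2 - z')) g - M ({y : (quasiSplit F E c 3).Adelic | T < borelHeight y}.indicator (flatSectionU φ' z' + flatSectionU φt' (2 - z'))) g) →
        ∫ g, (β g).toReal • (({y : (quasiSplit F E c 3).Adelic | borelHeight y ≤ T}.indicator (flatSectionU φ z) g - {y : (quasiSplit F E c 3).Adelic | T < borelHeight y}.indicator (flatSectionU φt (2 - z)) g) * conj (M ({y : (quasiSplit F E c 3).Adelic | T < borelHeight y}.indicator (flatSectionU φ' z' + flatSectionU φt' (2 - z'))) g)) ∂νG = ∫ g, (β g).toReal • (M' (fun x => {y : (quasiSplit F E c 3).Adelic | borelHeight y ≤ T}.indicator (flatSectionU φ z) x - {y : (quasiSplit F E c 3).Adelic | T < borelHeight y}.indicator (flatSectionU φt (2 - z)) x) g * conj (({y : (quasiSplit F E c 3).Adelic | T < borelHeight y}.indicator (flatSectionU φ' z' + flatSectionU φt' (2 - z'))) g)) ∂νG →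
        (∀ g, T < borelHeight g → M' (fun x => {y : (quasiSplit F E c 3).Adelic | borelHeight y ≤ T}.indicator (flatSectionU φ z) x - {y : (quasiSplit F E c 3).Adelic | T < borelHeight y}.indicator (flatSectionU φt (2 - z)) x) g = flatSectionU φt (2 - z) g) →
        Integrable (fun g => (β g).toReal • (({y : (quasiSplit F E c 3).Adelic | borelHeight y ≤ T}.indicator (flatSectionU φ z) g - {y : (quasiSplit F E c 3).Adelic | T < borelHeight y}.indicator (flatSectionU φt (2 - z)) g) * conj (M ({y : (quasiSplit F E c 3).Adelic | T < borelHeight y}.indicator (flatSectionU φ' z' + flatSectionU φt' (2 - z'))) g))) νG →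
      -- the four idele-class weights `Ξ₁…Ξ₄` = torus∕`K_U`-averages of the coefficient pairs (★ p857588 dichotomy decides them per character)
      ∀ {Ξ₁ Ξ₂ Ξ₃ Ξ₄ : (AdeleRing (𝓞 E) E)ˣ → ℂ},
      Measurable Ξ₁ → ∀ {CΞ₁ : ℝ}, (∀ x, ‖Ξ₁ x‖ ≤ CΞ₁) → (∀ k ∈ GaloisRepresentations.principalIdeles E, ∀ x, Ξ₁ (k * x) = Ξ₁ x) →
        (∀ (r : ℝ≥0ˣ) (x : (AdeleRing (𝓞 E) E)ˣ), Ξ₁ (posRealIdele E r * x) = Ξ₁ x) →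
        (∀ t : torusInBorel F E c 3,
          ∫ k, φ (((t : borelAdelic F E c 3) : (quasiSplit F E c 3).Adelic) * (k : (quasiSplit F E c 3).Adelic)) *
              conj (φ' (((t : borelAdelic F E c 3) : (quasiSplit F E c 3).Adelic) * (k : (quasiSplit F E c 3).Adelic))) ∂μK = Ξ₁ (diagUnit (t : borelAdelic F E c 3).2 0)) →
      Measurable Ξ₂ → ∀ {CΞ₂ : ℝ}, (∀ x, ‖Ξ₂ x‖ ≤ CΞ₂) → (∀ k ∈ GaloisRepresentations.principalIdeles E, ∀ x, Ξ₂ (k * x) = Ξ₂ x) →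
        (∀ (r : ℝ≥0ˣ) (x : (AdeleRing (𝓞 E) E)ˣ), Ξ₂ (posRealIdele E r * x) = Ξ₂ x) →
        (∀ t : torusInBorel F E c 3,
          ∫ k, φ (((t : borelAdelic F E c 3) : (quasiSplit F E c 3).Adelic) * (k : (quasiSplit F E c 3).Adelic)) *
              conj (φt' (((t : borelAdelic F E c 3) : (quasiSplit F E c 3).Adelic) * (k : (quasiSplit F E c 3).Adelic))) ∂μK = Ξ₂ (diagUnit (t : borelAdelic F E c 3).2 0)) →
      Measurable Ξ₃ → ∀ {CΞ₃ : ℝ}, (∀ x, ‖Ξ₃ x‖ ≤ CΞ₃) → (∀ k ∈ GaloisRepresentations.principalIdeles E, ∀ x, Ξ₃ (k * x) = Ξ₃ x) →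
        (∀ (r : ℝ≥0ˣ) (x : (AdeleRing (𝓞 E) E)ˣ), Ξ₃ (posRealIdele E r * x) = Ξ₃ x) →
        (∀ t : torusInBorel F E c 3,
          ∫ k, φt (((t : borelAdelic F E c 3) : (quasiSplit F E c 3).Adelic) * (k : (quasiSplit F E c 3).Adelic)) *
              conj (φ' (((t : borelAdelic F E c 3) : (quasiSplit F E c 3).Adelic) * (k : (quasiSplit F E c 3).Adelic))) ∂μK = Ξ₃ (diagUnit (t : borelAdelic F E c 3).2 0)) →
      Measurable Ξ₄ → ∀ {CΞ₄ : ℝ}, (∀ x, ‖Ξ₄ x‖ ≤ CΞ₄) → (∀ k ∈ GaloisRepresentations.principalIdeles E, ∀ x, Ξ₄ (k * x) = Ξ₄ x) →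
        (∀ (r : ℝ≥0ˣ) (x : (AdeleRing (𝓞 E) E)ˣ), Ξ₄ (posRealIdele E r * x) = Ξ₄ x) →
        (∀ t : torusInBorel F E c 3,
          ∫ k, φt (((t : borelAdelic F E c 3) : (quasiSplit F E c 3).Adelic) * (k : (quasiSplit F E c 3).Adelic)) *
              conj (φt' (((t : borelAdelic F E c 3) : (quasiSplit F E c 3).Adelic) * (k : (quasiSplit F E c 3).Adelic))) ∂μK = Ξ₄ (diagUnit (t : borelAdelic F E c 3).2 0)) →
      -- THE MAASS–SELBERG RELATION for flat sections of `U(J₃)`, `s₁ = z + conj z′ − 2`, `s₂ = z − conj z′`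
        ∫ x, (quasiSplit F E c 3).quotFun (truncation ν 𝓕 T (eisensteinSeriesU (flatSectionU φ z))) x * conj ((quasiSplit F E c 3).quotFun Λ' x) ∂μ =
          (cμ : ℂ) * ((K : ℂ) *
            ((((T : ℝ) : ℂ) ^ (z + conj z' - 2) / (z + conj z' - 2)) * (∫ x in {x : (AdeleRing (𝓞 E) E)ˣ | (IdeleClassGroup.ideleNorm E x : ℝ) ≤ 1} ∩ 𝓕I, ((IdeleClassGroup.ideleNorm E x : ℝ) : ℂ) * Ξ₁ x ∂νI)
              + (((T : ℝ) : ℂ) ^ (z - conj z') / (z - conj z')) * (∫ x in {x : (AdeleRing (𝓞 E) E)ˣ | (IdeleClassGroup.ideleNorm E x : ℝ) ≤ 1} ∩ 𝓕I, ((IdeleClassGroup.ideleNorm E x : ℝ) : ℂ) * Ξ₂ x ∂νI)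
              - (((T : ℝ) : ℂ) ^ (-(z - conj z')) / (z - conj z')) * (∫ x in {x : (AdeleRing (𝓞 E) E)ˣ | (IdeleClassGroup.ideleNorm E x : ℝ) ≤ 1} ∩ 𝓕I, ((IdeleClassGroup.ideleNorm E x : ℝ) : ℂ) * Ξ₃ x ∂νI)
              - (((T : ℝ) : ℂ) ^ (-(z + conj z' - 2)) / (z + conj z' - 2)) * (∫ x in {x : (AdeleRing (𝓞 E) E)ˣ | (IdeleClassGroup.ideleNorm E x : ℝ) ≤ 1} ∩ 𝓕I, ((IdeleClassGroup.ideleNorm E x : ℝ) : ℂ) * Ξ₄ x ∂νI))) := by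
  obtain ⟨cμ, hcμ, hMS⟩ := maassSelberg_inner_truncation_three μ νG νI h𝓕I
  obtain ⟨K, hK, hBr⟩ := exists_integral_weight_smul_cutoffs_flatSectionU_mul_conj_eq_three h2 hc hc1 νG μK νI hBK h𝓕I
  refine ⟨cμ, K, hcμ, hK, ?_⟩
  intro β hβ ν 𝓕 T hT φ φ' φt φt' hφm hφN hφB Cφ hφC hφ'm hφ'N hφ'B Cφ' hφ'C hφtm hφtN hφtB Cφt hφtC hφt'm hφt'N hφt'B Cφt' hφt'C
    z z' hz' hzz' hCT hsum Λ' CT' M M' hΛm hΛG M₁ hΛbdd hψL1 hAVG hCT' hadj hM'ψ hi₅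
    Ξ₁ Ξ₂ Ξ₃ Ξ₄ hΞ₁m CΞ₁ hΞ₁C hΞ₁K hΞ₁M hΞ₁ hΞ₂m CΞ₂ hΞ₂C hΞ₂K hΞ₂M hΞ₂ hΞ₃m CΞ₃ hΞ₃C hΞ₃K hΞ₃M hΞ₃ hΞ₄m CΞ₄ hΞ₄C hΞ₄K hΞ₄M hΞ₄
  have hT0 : (0 : ℝ≥0) < T := lt_of_lt_of_le one_pos hT
  -- exponent bookkeeping on the sub-tube
  have hs₁ : 0 < (z + conj z' - 2).re := by simp only [Complex.sub_re, Complex.add_re, Complex.conj_re]; norm_num; linarith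
  have hs₂ : 0 < (z - conj z').re := by simp only [Complex.sub_re, Complex.conj_re]; linarith
  have e₁ : 2 < (z + conj z').re := by simp only [Complex.add_re, Complex.conj_re]; linarith
  have e₂ : 2 < (z + conj (2 - z')).re := by simp only [Complex.add_re, Complex.conj_re, Complex.sub_re]; norm_num; linarith
  have e₃ : ((2 - z) + conj z').re < 2 := by simp only [Complex.add_re, Complex.conj_re, Complex.sub_re]; norm_num; linarith
  have e₄ : ((2 - z) + conj (2 - z')).re < 2 := by simp only [Complex.add_re, Complex.conj_re, Complex.sub_re]; norm_num; linarith
  -- the four brackets from ★ (C1)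
  have h₁ := ((hBr hβ hT0 hφm hφ'm hφN hφ'N hφB hφ'B hφC hφ'C (a := z) (a' := z') hΞ₁m hΞ₁K hΞ₁).1 e₁)
  have h₂ := ((hBr hβ hT0 hφm hφt'm hφN hφt'N hφB hφt'B hφC hφt'C (a := z) (a' := 2 - z') hΞ₂m hΞ₂K hΞ₂).1 e₂)
  have h₃ := ((hBr hβ hT0 hφtm hφ'm hφtN hφ'N hφtB hφ'B hφtC hφ'C (a := 2 - z) (a' := z') hΞ₃m hΞ₃K hΞ₃).2 e₃)
  have h₄ := ((hBr hβ hT0 hφtm hφt'm hφtN hφt'N hφtB hφt'B hφtC hφt'C (a := 2 - z) (a' := 2 - z') hΞ₄m hΞ₄K hΞ₄).2 e₄)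
  have q₂ : z + conj (2 - z') = (z - conj z') + 2 := by rw [map_sub, map_ofNat]; ring
  have q₃ : (2 - z) + conj z' = -(z - conj z') + 2 := by ring
  have q₄ : (2 - z) + conj (2 - z') = -(z + conj z' - 2) + 2 := by rw [map_sub, map_ofNat]; ring
  simp_rw [q₂] at h₂
  simp_rw [q₃] at h₃
  simp_rw [q₄] at h₄
  -- invariance∕measurability of the flat sections
  have hfm : Measurable (flatSectionU φ z) := measurable_flatSectionU hφm z
  have hMfm : Measurable (flatSectionU φt (2 - z)) := measurable_flatSectionU hφtm (2 - z)
  have hfB : ∀ b ∈ arithmeticBorel F E c 3, ∀ x : (quasiSplit F E c 3).Adelic, flatSectionU φ z ((b : (quasiSplit F E c 3).Adelic) * x) = flatSectionU φ z x := fun b hb x => by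
    rw [flatSectionU_apply, flatSectionU_apply, hφB b hb x, borelHeight_arithmeticBorel_mul hb]
  have hMfB : ∀ b ∈ arithmeticBorel F E c 3, ∀ x : (quasiSplit F E c 3).Adelic, flatSectionU φt (2 - z) ((b : (quasiSplit F E c 3).Adelic) * x) = flatSectionU φt (2 - z) x := fun b hb x => by
    rw [flatSectionU_apply, flatSectionU_apply, hφtB b hb x, borelHeight_arithmeticBorel_mul hb]
  have key := hMS hβ hT hfm hMfm hfB hMfB hCT hsum hΛm hΛG hΛbdd hψL1 hAVG hCT' hadj hM'ψ h₁.1 h₂.1 h₃.1 h₄.1 hi₅ hs₁ hs₂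
    hΞ₁m hΞ₁C hΞ₁K hΞ₁M hΞ₂m hΞ₂C hΞ₂K hΞ₂M hΞ₃m hΞ₃C hΞ₃K hΞ₃M hΞ₄m hΞ₄C hΞ₄K hΞ₄M
    (by simpa only [sub_add_cancel] using h₁.2) h₂.2 h₃.2 h₄.2
  exact key

end Generic

/-! ## §2 The CM pair `(L⁺, L, conj)`: every structural input of §1 is ★ — `h2`, `hc`, `hc1`, Iwasawa, and the summability `hsum` -/

section CM

variable (L : Type) [Field L] [NumberField L] [IsCMField L]

/-- **`hsum` AT THE CM PAIR** (★ R2 CM p857478, `Re z > 2`, bounded coefficient): the Eisenstein series of the flat section `f_z = φ·H^z` of `U(J₃)` over `(L⁺, L, conj)` converges (absolutely)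
at every `g` — the `hsum` input of §1 `maassSelberg_flatSectionU_three`, which at the CM pair is therefore applied as
`maassSelberg_flatSectionU_three (Algebra.IsQuadraticExtension.finrank_eq_two ↥(maximalRealSubfield L) L) (AlgEquiv.ext fun x => IsCMField.complexConj_apply_apply L x)
(IsCMField.complexConj_ne_one L) μ νG μK νI (exists_mem_borelAdelic_mul_mem_standardMaximalCompactGL_cm_three L) h𝓕I` with `hsum := summable_flatSectionU_cm_three L hz hφ`
(`2 < Re z` follows from the sub-tube `2 < Re z′ < Re z`). [cite: Godement1964, §8] [cite: MoeglinWaldspurger1995, II.1.5] -/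
theorem summable_flatSectionU_cm_three {z : ℂ} (hz : 2 < z.re)
    {φ : (quasiSplit (↥(maximalRealSubfield L)) L (IsCMField.complexConj L) 3).Adelic → ℂ} {C : ℝ} (hφ : ∀ x, ‖φ x‖ ≤ C)
    (g : (quasiSplit (↥(maximalRealSubfield L)) L (IsCMField.complexConj L) 3).Adelic) :
    Summable fun q : Quotient (orbitRel ↥(borelU ((IsCMField.complexConj L : L ≃ₐ[↥(maximalRealSubfield L)] L) : L →+* L) ((StdForm.antidiagonal 3).over L))
        ↥(unitaryGroupOfForm ((IsCMField.complexConj L : L ≃ₐ[↥(maximalRealSubfield L)] L) : L →+* L) ((StdForm.antidiagonal 3).over L))) =>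
      flatSectionU φ z ((quasiSplit (↥(maximalRealSubfield L)) L (IsCMField.complexConj L) 3).toAdelic
          (Quotient.out q : ↥(unitaryGroupOfForm ((IsCMField.complexConj L : L ≃ₐ[↥(maximalRealSubfield L)] L) : L →+* L) ((StdForm.antidiagonal 3).over L))) * g) :=
  (summable_eisensteinSeriesU_flatSectionU_cm_three L hz hφ g).of_norm

/-- The sub-tube `2 < Re z′ < Re z` implies `2 < Re z` (so `hsum` above applies to `f_z`, and by `hz′` to `f′_{z′}`). [folklore] -/
theorem two_lt_re_of_subtube {z z' : ℂ} (hz' : 2 < z'.re) (hzz' : z'.re < z.re) : 2 < z.re := hz'.trans hzz'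

end CM

/-! ## §3 (ED. 2) `hAVG` DISCHARGED: averaging over `N(F)∖N(𝔸)` by ★ p857644 `K2E1BorelWeightAverage` (`CT′ := borelConstantTerm ν 𝓕 Λ′`) -/

section Averaged

open Summit.HodgeConjecture.HodgeConjecture.Cruxes.H413.K2E1TruncatedEisensteinExplicit (forall_arithmeticBorel_indicator)
open Summit.HodgeConjecture.HodgeConjecture.Cruxes.H413.K2E1BorelWeightAverage

variable {F E : Type} [Field F] [NumberField F] [Field E] [NumberField E] [Algebra F E] {c : E ≃ₐ[F] E}
variable [MeasurableSpace (quasiSplit F E c 3).Adelic] [BorelSpace (quasiSplit F E c 3).Adelic]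
variable [MeasurableSpace (AdeleRing (𝓞 E) E)ˣ] [BorelSpace (AdeleRing (𝓞 E) E)ˣ]

omit [MeasurableSpace (quasiSplit F E c 3).Adelic] [BorelSpace (quasiSplit F E c 3).Adelic] [MeasurableSpace (AdeleRing (𝓞 E) E)ˣ] [BorelSpace (AdeleRing (𝓞 E) E)ˣ] in
/-- Height cut-offs see only the height: `𝟙_{H ≤ T} F₁ (x) = 𝟙_{H ≤ T} F₁ (y)` and `𝟙_{T < H} F₁ (x) = 𝟙_{T < H} F₁ (y)` when `H x = H y` and `F₁ x = F₁ y`. [folklore] -/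
theorem indicator_height_apply_eq {T : ℝ≥0} {F₁ : (quasiSplit F E c 3).Adelic → ℂ} {x y : (quasiSplit F E c 3).Adelic} (hH : borelHeight x = borelHeight y) (hF : F₁ x = F₁ y) :
    {y : (quasiSplit F E c 3).Adelic | borelHeight y ≤ T}.indicator F₁ x = {y : (quasiSplit F E c 3).Adelic | borelHeight y ≤ T}.indicator F₁ y ∧
      {y : (quasiSplit F E c 3).Adelic | T < borelHeight y}.indicator F₁ x = {y : (quasiSplit F E c 3).Adelic | T < borelHeight y}.indicator F₁ y := by
  refine ⟨?_, ?_⟩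
  · by_cases hy : borelHeight y ≤ T
    · rw [indicator_of_mem (show x ∈ {y : (quasiSplit F E c 3).Adelic | borelHeight y ≤ T} by rw [Set.mem_setOf_eq, hH]; exact hy), indicator_of_mem (show y ∈ {y : (quasiSplit F E c 3).Adelic | borelHeight y ≤ T} from hy), hF]
    · rw [indicator_of_notMem (show x ∉ {y : (quasiSplit F E c 3).Adelic | borelHeight y ≤ T} by rw [Set.mem_setOf_eq, hH]; exact hy), indicator_of_notMem (show y ∉ {y : (quasiSplit F E c 3).Adelic | borelHeight y ≤ T} from hy)]
  · by_cases hy : T < borelHeight y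
    · rw [indicator_of_mem (show x ∈ {y : (quasiSplit F E c 3).Adelic | T < borelHeight y} by rw [Set.mem_setOf_eq, hH]; exact hy), indicator_of_mem (show y ∈ {y : (quasiSplit F E c 3).Adelic | T < borelHeight y} from hy), hF]
    · rw [indicator_of_notMem (show x ∉ {y : (quasiSplit F E c 3).Adelic | T < borelHeight y} by rw [Set.mem_setOf_eq, hH]; exact hy), indicator_of_notMem (show y ∉ {y : (quasiSplit F E c 3).Adelic | T < borelHeight y} from hy)]

/-- **THE MAASS–SELBERG RELATION FOR FLAT SECTIONS OF `U(J₃)` WITH THE AVERAGING DISCHARGED** (ED. 2 of §1): the same statement as `maassSelberg_flatSectionU_three` with `ν` an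
inversion-invariant Haar measure on `N(𝔸)`, `𝓕` a fundamental domain of `N(F)` of finite positive measure, the second constant term SPELLED `CT′ := borelConstantTerm ν 𝓕 Λ′`, and the
hypothesis `hAVG` REMOVED — supplied inside by ★ p857644 `integral_wt_smul_mul_conj_eq_mul_conj_borelConstantTerm_three` (ψ is Borel, left-`N(𝔸)`- and `B(F)`-invariant because the
cut-offs see only the height ★ `borelHeight_unipotent_mul` ∕ ★ `forall_arithmeticBorel_indicator`; `∫⁻ β‖ψ·conj Λ′‖ₑ ≤ (∫⁻ β‖ψ‖ₑ)·M₁ < ∞`).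
[cite: MoeglinWaldspurger1995, II.1.8 and IV.2.1–IV.2.3] [cite: Arthur1980TraceFormulaII, §4] [cite: Garrett2018, §1.10 and §11.3] -/
theorem maassSelberg_flatSectionU_three_avg (h2 : Module.finrank F E = 2) (hc : c * c = 1) (hc1 : c ≠ 1)
    (μ : Measure (quasiSplit F E c 3).automorphicQuotient) [(quasiSplit F E c 3).IsAutomorphicMeasure μ]
    (νG : Measure (quasiSplit F E c 3).Adelic) [νG.IsHaarMeasure] [νG.IsInvInvariant]
    (μK : Measure ((standardMaximalCompactGL 3 E).comap (adelicVal F E c 3 ((StdForm.antidiagonal 3).over E)) : Subgroup (quasiSplit F E c 3).Adelic))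
    [μK.IsHaarMeasure]
    (νI : Measure (AdeleRing (𝓞 E) E)ˣ) [νI.IsHaarMeasure]
    (hBK : ∀ g : (quasiSplit F E c 3).Adelic, ∃ b ∈ borelAdelic F E c 3, ∃ k : (quasiSplit F E c 3).Adelic,
      adelicVal F E c 3 ((StdForm.antidiagonal 3).over E) k ∈ standardMaximalCompactGL 3 E ∧ g = b * k)
    {𝓕I : Set (AdeleRing (𝓞 E) E)ˣ} (h𝓕I : IsIdeleClassDomain E 𝓕I)
    (ν : Measure ↥(adelicUnipotent F E c 3)) [ν.IsHaarMeasure] [ν.IsInvInvariant]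
    {𝓕 : Set ↥(adelicUnipotent F E c 3)} (h𝓕N : IsFundamentalDomain ↥(rationalUnipotent F E c 3) 𝓕 ν) (h𝓕₀ : ν 𝓕 ≠ 0) (h𝓕top : ν 𝓕 ≠ ∞) :
    ∃ cμ K : ℝ, 0 < cμ ∧ 0 < K ∧
      ∀ {β : (quasiSplit F E c 3).Adelic → ℝ≥0∞}, IsCoveringWeight ((arithmeticBorel F E c 3).map (quasiSplit F E c 3).arithmeticSubgroup.subtype) β →
      ∀ {T : ℝ≥0}, 1 ≤ T →
      ∀ {φ φ' φt φt' : (quasiSplit F E c 3).Adelic → ℂ},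
      Measurable φ →
        (∀ (n : unipotentInBorel F E c 3) (y : (quasiSplit F E c 3).Adelic), φ (((n : borelAdelic F E c 3) : (quasiSplit F E c 3).Adelic) * y) = φ y) →
        (∀ b ∈ arithmeticBorel F E c 3, ∀ y : (quasiSplit F E c 3).Adelic, φ ((b : (quasiSplit F E c 3).Adelic) * y) = φ y) →
      ∀ {Cφ : ℝ}, (∀ x, ‖φ x‖ ≤ Cφ) →
      Measurable φ' →
        (∀ (n : unipotentInBorel F E c 3) (y : (quasiSplit F E c 3).Adelic), φ' (((n : borelAdelic F E c 3) : (quasiSplit F E c 3).Adelic) * y) = φ' y) →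
        (∀ b ∈ arithmeticBorel F E c 3, ∀ y : (quasiSplit F E c 3).Adelic, φ' ((b : (quasiSplit F E c 3).Adelic) * y) = φ' y) →
      ∀ {Cφ' : ℝ}, (∀ x, ‖φ' x‖ ≤ Cφ') →
      Measurable φt →
        (∀ (n : unipotentInBorel F E c 3) (y : (quasiSplit F E c 3).Adelic), φt (((n : borelAdelic F E c 3) : (quasiSplit F E c 3).Adelic) * y) = φt y) →
        (∀ b ∈ arithmeticBorel F E c 3, ∀ y : (quasiSplit F E c 3).Adelic, φt ((b : (quasiSplit F E c 3).Adelic) * y) = φt y) →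
      ∀ {Cφt : ℝ}, (∀ x, ‖φt x‖ ≤ Cφt) →
      Measurable φt' →
        (∀ (n : unipotentInBorel F E c 3) (y : (quasiSplit F E c 3).Adelic), φt' (((n : borelAdelic F E c 3) : (quasiSplit F E c 3).Adelic) * y) = φt' y) →
        (∀ b ∈ arithmeticBorel F E c 3, ∀ y : (quasiSplit F E c 3).Adelic, φt' ((b : (quasiSplit F E c 3).Adelic) * y) = φt' y) →
      ∀ {Cφt' : ℝ}, (∀ x, ‖φt' x‖ ≤ Cφt') →
      ∀ {z z' : ℂ}, 2 < z'.re → z'.re < z.re →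
        (∀ x : (quasiSplit F E c 3).Adelic, T < borelHeight x → borelConstantTerm ν 𝓕 (eisensteinSeriesU (flatSectionU φ z)) x = flatSectionU φ z x + flatSectionU φt (2 - z) x) →
        (∀ g : (quasiSplit F E c 3).Adelic,
          Summable fun q : Quotient (orbitRel ↥(borelU (c : E →+* E) ((StdForm.antidiagonal 3).over E)) ↥(unitaryGroupOfForm (c : E →+* E) ((StdForm.antidiagonal 3).over E))) =>
            flatSectionU φ z ((quasiSplit F E c 3).toAdelic (q.out : ↥(unitaryGroupOfForm (c : E →+* E) ((StdForm.antidiagonal 3).over E))) * g)) →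
      ∀ {Λ' : (quasiSplit F E c 3).Adelic → ℂ} {M M' : ((quasiSplit F E c 3).Adelic → ℂ) → ((quasiSplit F E c 3).Adelic → ℂ)},
        Measurable Λ' → (∀ (γ : (quasiSplit F E c 3).arithmeticSubgroup) (x : (quasiSplit F E c 3).Adelic), Λ' ((γ : (quasiSplit F E c 3).Adelic) * x) = Λ' x) →
        ∀ {M₁ : ℝ}, (∀ g, ‖Λ' g‖ ≤ M₁) →
        ∫⁻ g, β g * ‖({y : (quasiSplit F E c 3).Adelic | borelHeight y ≤ T}.indicator (flatSectionU φ z) g - {y : (quasiSplit F E c 3).Adelic | T < borelHeight y}.indicator (flatSectionU φt (2 - z)) g)‖ₑ ∂νG < ∞ →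
        (∀ g, borelConstantTerm ν 𝓕 Λ' g = {y : (quasiSplit F E c 3).Adelic | borelHeight y ≤ T}.indicator (flatSectionU φ' z' + flatSectionU φt' (2 - z')) g - M ({y : (quasiSplit F E c 3).Adelic | T < borelHeight y}.indicator (flatSectionU φ' z' + flatSectionU φt' (2 - z'))) g) →
        ∫ g, (β g).toReal • (({y : (quasiSplit F E c 3).Adelic | borelHeight y ≤ T}.indicator (flatSectionU φ z) g - {y : (quasiSplit F E c 3).Adelic | T < borelHeight y}.indicator (flatSectionU φt (2 - z)) g) * conj (M ({y : (quasiSplit F E c 3).Adelic | T < borelHeight y}.indicator (flatSectionU φ' z' + flatSectionU φt' (2 - z'))) g)) ∂νG = ∫ g, (β g).toReal • (M' (fun x => {y : (quasiSplit F E c 3).Adelic | borelHeight y ≤ T}.indicator (flatSectionU φ z) x - {y : (quasiSplit F E c 3).Adelic | T < borelHeight y}.indicator (flatSectionU φt (2 - z)) x) g * conj (({y : (quasiSplit F E c 3).Adelic | T < borelHeight y}.indicator (flatSectionU φ' z' + flatSectionU φt' (2 - z'))) g)) ∂νG →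
        (∀ g, T < borelHeight g → M' (fun x => {y : (quasiSplit F E c 3).Adelic | borelHeight y ≤ T}.indicator (flatSectionU φ z) x - {y : (quasiSplit F E c 3).Adelic | T < borelHeight y}.indicator (flatSectionU φt (2 - z)) x) g = flatSectionU φt (2 - z) g) →
        Integrable (fun g => (β g).toReal • (({y : (quasiSplit F E c 3).Adelic | borelHeight y ≤ T}.indicator (flatSectionU φ z) g - {y : (quasiSplit F E c 3).Adelic | T < borelHeight y}.indicator (flatSectionU φt (2 - z)) g) * conj (M ({y : (quasiSplit F E c 3).Adelic | T < borelHeight y}.indicator (flatSectionU φ' z' + flatSectionU φt' (2 - z'))) g))) νG →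
      ∀ {Ξ₁ Ξ₂ Ξ₃ Ξ₄ : (AdeleRing (𝓞 E) E)ˣ → ℂ},
      Measurable Ξ₁ → ∀ {CΞ₁ : ℝ}, (∀ x, ‖Ξ₁ x‖ ≤ CΞ₁) → (∀ k ∈ GaloisRepresentations.principalIdeles E, ∀ x, Ξ₁ (k * x) = Ξ₁ x) →
        (∀ (r : ℝ≥0ˣ) (x : (AdeleRing (𝓞 E) E)ˣ), Ξ₁ (posRealIdele E r * x) = Ξ₁ x) →
        (∀ t : torusInBorel F E c 3,
          ∫ k, φ (((t : borelAdelic F E c 3) : (quasiSplit F E c 3).Adelic) * (k : (quasiSplit F E c 3).Adelic)) *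
              conj (φ' (((t : borelAdelic F E c 3) : (quasiSplit F E c 3).Adelic) * (k : (quasiSplit F E c 3).Adelic))) ∂μK = Ξ₁ (diagUnit (t : borelAdelic F E c 3).2 0)) →
      Measurable Ξ₂ → ∀ {CΞ₂ : ℝ}, (∀ x, ‖Ξ₂ x‖ ≤ CΞ₂) → (∀ k ∈ GaloisRepresentations.principalIdeles E, ∀ x, Ξ₂ (k * x) = Ξ₂ x) →
        (∀ (r : ℝ≥0ˣ) (x : (AdeleRing (𝓞 E) E)ˣ), Ξ₂ (posRealIdele E r * x) = Ξ₂ x) →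
        (∀ t : torusInBorel F E c 3,
          ∫ k, φ (((t : borelAdelic F E c 3) : (quasiSplit F E c 3).Adelic) * (k : (quasiSplit F E c 3).Adelic)) *
              conj (φt' (((t : borelAdelic F E c 3) : (quasiSplit F E c 3).Adelic) * (k : (quasiSplit F E c 3).Adelic))) ∂μK = Ξ₂ (diagUnit (t : borelAdelic F E c 3).2 0)) →
      Measurable Ξ₃ → ∀ {CΞ₃ : ℝ}, (∀ x, ‖Ξ₃ x‖ ≤ CΞ₃) → (∀ k ∈ GaloisRepresentations.principalIdeles E, ∀ x, Ξ₃ (k * x) = Ξ₃ x) →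
        (∀ (r : ℝ≥0ˣ) (x : (AdeleRing (𝓞 E) E)ˣ), Ξ₃ (posRealIdele E r * x) = Ξ₃ x) →
        (∀ t : torusInBorel F E c 3,
          ∫ k, φt (((t : borelAdelic F E c 3) : (quasiSplit F E c 3).Adelic) * (k : (quasiSplit F E c 3).Adelic)) *
              conj (φ' (((t : borelAdelic F E c 3) : (quasiSplit F E c 3).Adelic) * (k : (quasiSplit F E c 3).Adelic))) ∂μK = Ξ₃ (diagUnit (t : borelAdelic F E c 3).2 0)) →
      Measurable Ξ₄ → ∀ {CΞ₄ : ℝ}, (∀ x, ‖Ξ₄ x‖ ≤ CΞ₄) → (∀ k ∈ GaloisRepresentations.principalIdeles E, ∀ x, Ξ₄ (k * x) = Ξ₄ x) →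
        (∀ (r : ℝ≥0ˣ) (x : (AdeleRing (𝓞 E) E)ˣ), Ξ₄ (posRealIdele E r * x) = Ξ₄ x) →
        (∀ t : torusInBorel F E c 3,
          ∫ k, φt (((t : borelAdelic F E c 3) : (quasiSplit F E c 3).Adelic) * (k : (quasiSplit F E c 3).Adelic)) *
              conj (φt' (((t : borelAdelic F E c 3) : (quasiSplit F E c 3).Adelic) * (k : (quasiSplit F E c 3).Adelic))) ∂μK = Ξ₄ (diagUnit (t : borelAdelic F E c 3).2 0)) →
        ∫ x, (quasiSplit F E c 3).quotFun (truncation ν 𝓕 T (eisensteinSeriesU (flatSectionU φ z))) x * conj ((quasiSplit F E c 3).quotFun Λ' x) ∂μ =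
          (cμ : ℂ) * ((K : ℂ) *
            ((((T : ℝ) : ℂ) ^ (z + conj z' - 2) / (z + conj z' - 2)) * (∫ x in {x : (AdeleRing (𝓞 E) E)ˣ | (IdeleClassGroup.ideleNorm E x : ℝ) ≤ 1} ∩ 𝓕I, ((IdeleClassGroup.ideleNorm E x : ℝ) : ℂ) * Ξ₁ x ∂νI)
              + (((T : ℝ) : ℂ) ^ (z - conj z') / (z - conj z')) * (∫ x in {x : (AdeleRing (𝓞 E) E)ˣ | (IdeleClassGroup.ideleNorm E x : ℝ) ≤ 1} ∩ 𝓕I, ((IdeleClassGroup.ideleNorm E x : ℝ) : ℂ) * Ξ₂ x ∂νI)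
              - (((T : ℝ) : ℂ) ^ (-(z - conj z')) / (z - conj z')) * (∫ x in {x : (AdeleRing (𝓞 E) E)ˣ | (IdeleClassGroup.ideleNorm E x : ℝ) ≤ 1} ∩ 𝓕I, ((IdeleClassGroup.ideleNorm E x : ℝ) : ℂ) * Ξ₃ x ∂νI)
              - (((T : ℝ) : ℂ) ^ (-(z + conj z' - 2)) / (z + conj z' - 2)) * (∫ x in {x : (AdeleRing (𝓞 E) E)ˣ | (IdeleClassGroup.ideleNorm E x : ℝ) ≤ 1} ∩ 𝓕I, ((IdeleClassGroup.ideleNorm E x : ℝ) : ℂ) * Ξ₄ x ∂νI))) := by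
  obtain ⟨cμ, K, hcμ, hK, hGen⟩ := maassSelberg_flatSectionU_three h2 hc hc1 μ νG μK νI hBK h𝓕I
  refine ⟨cμ, K, hcμ, hK, ?_⟩
  intro β hβ T hT φ φ' φt φt' hφm hφN hφB Cφ hφC hφ'm hφ'N hφ'B Cφ' hφ'C hφtm hφtN hφtB Cφt hφtC hφt'm hφt'N hφt'B Cφt' hφt'C
    z z' hz' hzz' hCT hsum Λ' M M' hΛm hΛG M₁ hΛbdd hψL1 hCT' hadj hM'ψ hi₅
    Ξ₁ Ξ₂ Ξ₃ Ξ₄ hΞ₁m CΞ₁ hΞ₁C hΞ₁K hΞ₁M hΞ₁ hΞ₂m CΞ₂ hΞ₂C hΞ₂K hΞ₂M hΞ₂ hΞ₃m CΞ₃ hΞ₃C hΞ₃K hΞ₃M hΞ₃ hΞ₄m CΞ₄ hΞ₄C hΞ₄K hΞ₄M hΞ₄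
  -- ψ is Borel, left-`N(𝔸)`- and `B(F)`-invariant, and `β·‖ψ·conj Λ′‖` is integrable
  have hSle : MeasurableSet {y : (quasiSplit F E c 3).Adelic | borelHeight y ≤ T} := (isClosed_setOf_borelHeight_le T).measurableSet
  have hSgt : MeasurableSet {y : (quasiSplit F E c 3).Adelic | T < borelHeight y} := measurableSet_lt measurable_const measurable_borelHeight
  have hψm : Measurable (fun x => {y : (quasiSplit F E c 3).Adelic | borelHeight y ≤ T}.indicator (flatSectionU φ z) x - {y : (quasiSplit F E c 3).Adelic | T < borelHeight y}.indicator (flatSectionU φt (2 - z)) x) :=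
    ((measurable_flatSectionU hφm z).indicator hSle).sub ((measurable_flatSectionU hφtm (2 - z)).indicator hSgt)
  have hψN : ∀ (u : ↥(adelicUnipotent F E c 3)) (g : (quasiSplit F E c 3).Adelic), (fun x => {y : (quasiSplit F E c 3).Adelic | borelHeight y ≤ T}.indicator (flatSectionU φ z) x - {y : (quasiSplit F E c 3).Adelic | T < borelHeight y}.indicator (flatSectionU φt (2 - z)) x) ((u : (quasiSplit F E c 3).Adelic) * g) = (fun x => {y : (quasiSplit F E c 3).Adelic | borelHeight y ≤ T}.indicator (flatSectionU φ z) x - {y : (quasiSplit F E c 3).Adelic | T < borelHeight y}.indicator (flatSectionU φt (2 - z)) x) g := by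
    intro u g
    have hn : u.1 ∈ adelicUnipotent F E c 3 := u.2
    have hH : borelHeight ((u : (quasiSplit F E c 3).Adelic) * g) = borelHeight g := borelHeight_unipotent_mul hn g
    have hφu : φ ((u : (quasiSplit F E c 3).Adelic) * g) = φ g :=
      hφN ⟨⟨(u : (quasiSplit F E c 3).Adelic), adelicUnipotent_le_borelAdelic hn⟩, (mem_unipotentInBorel_iff _).2 hn⟩ g
    have hφtu : φt ((u : (quasiSplit F E c 3).Adelic) * g) = φt g :=
      hφtN ⟨⟨(u : (quasiSplit F E c 3).Adelic), adelicUnipotent_le_borelAdelic hn⟩, (mem_unipotentInBorel_iff _).2 hn⟩ g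
    have hfu : flatSectionU φ z ((u : (quasiSplit F E c 3).Adelic) * g) = flatSectionU φ z g := by rw [flatSectionU_apply, flatSectionU_apply, hφu, hH]
    have hMfu : flatSectionU φt (2 - z) ((u : (quasiSplit F E c 3).Adelic) * g) = flatSectionU φt (2 - z) g := by rw [flatSectionU_apply, flatSectionU_apply, hφtu, hH]
    dsimp only
    rw [(indicator_height_apply_eq hH hfu).1, (indicator_height_apply_eq hH hMfu).2]
  have hfB : ∀ b ∈ arithmeticBorel F E c 3, ∀ x : (quasiSplit F E c 3).Adelic, flatSectionU φ z ((b : (quasiSplit F E c 3).Adelic) * x) = flatSectionU φ z x := fun b hb x => by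
    rw [flatSectionU_apply, flatSectionU_apply, hφB b hb x, borelHeight_arithmeticBorel_mul hb]
  have hMfB : ∀ b ∈ arithmeticBorel F E c 3, ∀ x : (quasiSplit F E c 3).Adelic, flatSectionU φt (2 - z) ((b : (quasiSplit F E c 3).Adelic) * x) = flatSectionU φt (2 - z) x := fun b hb x => by
    rw [flatSectionU_apply, flatSectionU_apply, hφtB b hb x, borelHeight_arithmeticBorel_mul hb]
  have hψB : ∀ b ∈ arithmeticBorel F E c 3, ∀ x : (quasiSplit F E c 3).Adelic, (fun x => {y : (quasiSplit F E c 3).Adelic | borelHeight y ≤ T}.indicator (flatSectionU φ z) x - {y : (quasiSplit F E c 3).Adelic | T < borelHeight y}.indicator (flatSectionU φt (2 - z)) x) ((b : (quasiSplit F E c 3).Adelic) * x) = (fun x => {y : (quasiSplit F E c 3).Adelic | borelHeight y ≤ T}.indicator (flatSectionU φ z) x - {y : (quasiSplit F E c 3).Adelic | T < borelHeight y}.indicator (flatSectionU φt (2 - z)) x) x := by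
    intro b hb x
    dsimp only
    rw [forall_arithmeticBorel_indicator hfB (fun h => h ≤ T) b hb x, forall_arithmeticBorel_indicator hMfB (fun h => T < h) b hb x]
  have hΛB : ∀ b ∈ arithmeticBorel F E c 3, ∀ x : (quasiSplit F E c 3).Adelic, Λ' ((b : (quasiSplit F E c 3).Adelic) * x) = Λ' x := fun b _ x => hΛG b x
  have hL1 : ∫⁻ g, β g * ‖({y : (quasiSplit F E c 3).Adelic | borelHeight y ≤ T}.indicator (flatSectionU φ z) g - {y : (quasiSplit F E c 3).Adelic | T < borelHeight y}.indicator (flatSectionU φt (2 - z)) g) * conj (Λ' g)‖ₑ ∂νG < ∞ := by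
    have hM : ∀ g, ‖conj (Λ' g)‖ₑ ≤ ENNReal.ofReal M₁ := fun g => by
      rw [← ofReal_norm, Complex.norm_conj]; exact ENNReal.ofReal_le_ofReal (hΛbdd g)
    calc ∫⁻ g, β g * ‖({y : (quasiSplit F E c 3).Adelic | borelHeight y ≤ T}.indicator (flatSectionU φ z) g - {y : (quasiSplit F E c 3).Adelic | T < borelHeight y}.indicator (flatSectionU φt (2 - z)) g) * conj (Λ' g)‖ₑ ∂νG
        ≤ ∫⁻ g, β g * ‖({y : (quasiSplit F E c 3).Adelic | borelHeight y ≤ T}.indicator (flatSectionU φ z) g - {y : (quasiSplit F E c 3).Adelic | T < borelHeight y}.indicator (flatSectionU φt (2 - z)) g)‖ₑ * ENNReal.ofReal M₁ ∂νG := lintegral_mono fun g => by rw [enorm_mul, ← mul_assoc]; gcongr; exact hM g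
      _ = (∫⁻ g, β g * ‖({y : (quasiSplit F E c 3).Adelic | borelHeight y ≤ T}.indicator (flatSectionU φ z) g - {y : (quasiSplit F E c 3).Adelic | T < borelHeight y}.indicator (flatSectionU φt (2 - z)) g)‖ₑ ∂νG) * ENNReal.ofReal M₁ := lintegral_mul_const' _ _ ENNReal.ofReal_ne_top
      _ < ∞ := ENNReal.mul_lt_top hψL1 ENNReal.ofReal_lt_top
  have hAVG := integral_wt_smul_mul_conj_eq_mul_conj_borelConstantTerm_three hc hc1 νG ν h𝓕N h𝓕₀ h𝓕top hβ hψm hΛm hψN hψB hΛB hL1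
  exact hGen hβ hT hφm hφN hφB hφC hφ'm hφ'N hφ'B hφ'C hφtm hφtN hφtB hφtC hφt'm hφt'N hφt'B hφt'C hz' hzz' hCT hsum hΛm hΛG hΛbdd hψL1
    hAVG hCT' hadj hM'ψ hi₅ hΞ₁m hΞ₁C hΞ₁K hΞ₁M hΞ₁ hΞ₂m hΞ₂C hΞ₂K hΞ₂M hΞ₂ hΞ₃m hΞ₃C hΞ₃K hΞ₃M hΞ₃ hΞ₄m hΞ₄C hΞ₄K hΞ₄M hΞ₄

end Averaged

end Summit.HodgeConjecture.HodgeConjecture.Cruxes.H413.K2E1MaassSelbergCMThree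

end
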